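import Summits.QuantumFields.YangMills.Theorems.BalabanUVNodesN15PerCubeGreenKnitCloseSmall
import HarnessLib

/-!
# N15 = NE2, road (c) — PROGRAMME (PC), towards (PC-D): one real-arithmetic lemma for n15-c∕303 — the closeness constant of n15-c∕300's majorant (a left factor through the glued
# operator, two families) under the site smallness, reduced to n15-c∕295a `closeMaj_le` (dag-n15-c g29, n15-c∕303a)

Cell `pub-ymgap`, seat `pub-ymgap-dag-n15-c` (generation g29; R134 (a), s1; HUMAN RULING D-0062).  `bears_on: R4∕N15 · K3⁸ SpineGivenEndpointR13SepCoPHV (stmt-QuantumFields-27366)`;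
filed `--kind proof --supports stmt-QuantumFields-27366 --as helper` — COUNT-NEUTRAL.  Elementary real inequalities only; 0 `def`, 0 `sorry`.  Imports n15-c∕295a
`…PerCubeGreenKnitCloseSmall` (`closeMaj_le`) BY NAME.

WHAT.  `closeMajJet_le`: n15-c∕300 ∕ 301 ∕ 302's near∕far constant — n15-c∕292's with `β₁ ↦ B(1 + r_Pc_r)`, `ε_D ↦ ε_G + 2r_PBc_r` and the Leibniz letters `c_s, c_d` of the left
factors — equals `(c_s(1 + r_Pc_r) + c_d)` times n15-c∕292's constant plus `c_sr_Pc_r·N_ovc(2B − ε_G)·(Ic_r)` (a `ring` identity), hence is at most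
`B_out·((c_s(1 + r_Pc_r) + c_d)·(R_c + w⁻¹ + θ_F + t) + c_sr_P)` with n15-c∕295a's ONE `w`-free constant `B_out`.

HONEST FRAMING ∕ LIMITS.  Arithmetic; nothing of record touched; NE2⁺ NOT PRINTED, NOT proved; K3⁸ OPEN; counts UNMOVED.  Restate-immune (no Theses import).
-/

noncomputable section

namespace Summit.QuantumFields.YangMills.BalabanUVNodes.N15.Gluing

open Real

/-! ## §1 The closeness constant with a left factor -/

/-- the near∕far constant of n15-c∕302's majorant under the site smallness: with `κ = c_s(1 + r_Pc_r) + c_d` it is `κ·`(n15-c∕294's constant)` + c_sr_Pc_r·N_ovc(2B − ε_G)(Ic_r)`, so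
n15-c∕295a `closeMaj_le` (`E ≤ ½`, `E ≤ e₁w⁻¹ + e₂θ_F`, `B ≤ B̄`, `(1 − E)⁻¹ ≤ 2`, `β̄_w ≤ β̄`) bounds it by `B_out·(κ·(R_c + w⁻¹ + θ_F + t) + c_sr_P)` with the SAME `w`-free
constant `B_out`. [folklore] -/
theorem closeMajJet_le {Nov c B Bb I cr βw βb θ ε E t Rc e₁ e₂ w θF cs cd rP : ℝ}
    (hNov : 0 ≤ Nov) (hc : 0 ≤ c) (hB0 : 0 ≤ B) (hBb : B ≤ Bb) (hBb0 : 0 ≤ Bb) (hI0 : 0 ≤ I) (hI2 : I ≤ 2) (hcr : 0 ≤ cr) (hβw0 : 0 ≤ βw) (hβw : βw ≤ βb)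
    (hθ : 0 ≤ θ) (hε : 0 ≤ ε) (hEdef : Nov * (c * θ + c * ε) * cr = E) (hE2 : E ≤ 1 / 2) (ht0 : 0 ≤ t) (hRc : 0 ≤ Rc)
    (he₁ : 0 ≤ e₁) (he₂ : 0 ≤ e₂) (hw : 0 < w) (hθF : 0 ≤ θF) (hE1 : E ≤ e₁ * w⁻¹ + e₂ * θF) (hcs : 0 ≤ cs) (hcd : 0 ≤ cd) (hrP : 0 ≤ rP) :
    (Nov * (cs * (c * (2 * (βw * (Rc * B * cr) * cr) + 2 * (rP * B * cr))) + cd * (c * (2 * (βw * (Rc * B * cr) * cr)))) +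
          Nov * (cs * (c * (B + rP * B * cr)) + cd * (c * B)) * (I * cr) * (Nov * (c * (2 * θ) + c * (2 * ε))) * cr) * (I * cr) +
        (Nov * (cs * (2 * (c * (B + rP * B * cr))) + cd * (2 * (c * B))) + Nov * (cs * (c * (B + rP * B * cr)) + cd * (c * B)) * (I * cr) * (Nov * (2 * (c * ε)) + Nov * (2 * (c * θ))) * cr) *
          (I * cr) * t ≤
      (2 * cr * (2 * (Nov * (c * (βb * (Bb * cr) * cr)))) + 8 * cr * cr * (Nov * (c * Bb)) * e₁ + 8 * cr * cr * (Nov * (c * Bb)) * e₂ +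
          (2 * (Nov * (c * Bb)) + Nov * (c * Bb) * (2 * cr)) * (2 * cr) + 1) * ((cs * (1 + rP * cr) + cd) * ((Rc + w⁻¹) + θF + t) + cs * rP) := by
  have h0 := closeMaj_le hNov hc hB0 hBb hBb0 hI0 hI2 hcr hβw0 hβw hθ hε hEdef hE2 ht0 hRc he₁ he₂ hw hθF hE1
  set Bout : ℝ := 2 * cr * (2 * (Nov * (c * (βb * (Bb * cr) * cr)))) + 8 * cr * cr * (Nov * (c * Bb)) * e₁ + 8 * cr * cr * (Nov * (c * Bb)) * e₂ +
    (2 * (Nov * (c * Bb)) + Nov * (c * Bb) * (2 * cr)) * (2 * cr) + 1 with hBout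
  set S : ℝ := (Rc + w⁻¹) + θF + t with hS
  set L0 : ℝ := (Nov * (c * (2 * (βw * (Rc * B * cr) * cr))) + Nov * (c * B) * (I * cr) * (Nov * (c * (2 * θ) + c * (2 * ε))) * cr) * (I * cr) +
    (Nov * (2 * (c * B)) + Nov * (c * B) * (I * cr) * (Nov * (2 * (c * ε)) + Nov * (2 * (c * θ))) * cr) * (I * cr) * t with hL0
  have hκ : 0 ≤ cs * (1 + rP * cr) + cd := by positivity
  have e : (Nov * (cs * (c * (2 * (βw * (Rc * B * cr) * cr) + 2 * (rP * B * cr))) + cd * (c * (2 * (βw * (Rc * B * cr) * cr)))) +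
          Nov * (cs * (c * (B + rP * B * cr)) + cd * (c * B)) * (I * cr) * (Nov * (c * (2 * θ) + c * (2 * ε))) * cr) * (I * cr) +
        (Nov * (cs * (2 * (c * (B + rP * B * cr))) + cd * (2 * (c * B))) + Nov * (cs * (c * (B + rP * B * cr)) + cd * (c * B)) * (I * cr) * (Nov * (2 * (c * ε)) + Nov * (2 * (c * θ))) * cr) *
          (I * cr) * t =
      (cs * (1 + rP * cr) + cd) * L0 + cs * rP * cr * (Nov * c * (2 * B - 2 * (βw * (Rc * B * cr) * cr))) * (I * cr) := by
    rw [hL0]; ring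
  rw [e]
  have hIc : I * cr ≤ 2 * cr := mul_le_mul_of_nonneg_right hI2 hcr
  have hP : Nov * (c * B) ≤ Nov * (c * Bb) := mul_le_mul_of_nonneg_left (mul_le_mul_of_nonneg_left hBb hc) hNov
  have h1 : cs * rP * cr * (Nov * c * (2 * B - 2 * (βw * (Rc * B * cr) * cr))) * (I * cr) ≤ cs * rP * cr * (Nov * c * (2 * B)) * (2 * cr) := by
    have hEG : 0 ≤ 2 * (βw * (Rc * B * cr) * cr) := by positivity
    have hx : Nov * c * (2 * B - 2 * (βw * (Rc * B * cr) * cr)) ≤ Nov * c * (2 * B) := mul_le_mul_of_nonneg_left (by linarith) (mul_nonneg hNov hc)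
    have hx0 : 0 ≤ cs * rP * cr * (Nov * c * (2 * B)) := by positivity
    calc cs * rP * cr * (Nov * c * (2 * B - 2 * (βw * (Rc * B * cr) * cr))) * (I * cr) ≤ cs * rP * cr * (Nov * c * (2 * B)) * (I * cr) :=
          mul_le_mul_of_nonneg_right (mul_le_mul_of_nonneg_left hx (by positivity)) (by positivity)
      _ ≤ cs * rP * cr * (Nov * c * (2 * B)) * (2 * cr) := mul_le_mul_of_nonneg_left hIc hx0
  have h2 : cs * rP * cr * (Nov * c * (2 * B)) * (2 * cr) ≤ Bout * (cs * rP) := by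
    have hB4 : 4 * cr * cr * (Nov * (c * B)) ≤ Bout := by
      have t1 : 0 ≤ 2 * cr * (2 * (Nov * (c * (βb * (Bb * cr) * cr)))) := by
        have : 0 ≤ βb := hβw0.trans hβw
        positivity
      have t2 : 0 ≤ 8 * cr * cr * (Nov * (c * Bb)) * e₁ := by positivity
      have t3 : 0 ≤ 8 * cr * cr * (Nov * (c * Bb)) * e₂ := by positivity
      have t4 : 4 * cr * cr * (Nov * (c * B)) ≤ (2 * (Nov * (c * Bb)) + Nov * (c * Bb) * (2 * cr)) * (2 * cr) := by
        have u1 : 4 * cr * cr * (Nov * (c * B)) ≤ 4 * cr * cr * (Nov * (c * Bb)) := mul_le_mul_of_nonneg_left hP (by positivity)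
        have u2 : 0 ≤ 2 * (Nov * (c * Bb)) * (2 * cr) := by positivity
        nlinarith [u1, u2]
      rw [hBout]; linarith
    calc cs * rP * cr * (Nov * c * (2 * B)) * (2 * cr) = (4 * cr * cr * (Nov * (c * B))) * (cs * rP) := by ring
      _ ≤ Bout * (cs * rP) := mul_le_mul_of_nonneg_right hB4 (by positivity)
  have h3 : (cs * (1 + rP * cr) + cd) * L0 ≤ (cs * (1 + rP * cr) + cd) * (Bout * S) := mul_le_mul_of_nonneg_left h0 hκ
  calc (cs * (1 + rP * cr) + cd) * L0 + cs * rP * cr * (Nov * c * (2 * B - 2 * (βw * (Rc * B * cr) * cr))) * (I * cr)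
      ≤ (cs * (1 + rP * cr) + cd) * (Bout * S) + Bout * (cs * rP) := add_le_add h3 (h1.trans h2)
    _ = Bout * ((cs * (1 + rP * cr) + cd) * S + cs * rP) := by ring

end Summit.QuantumFields.YangMills.BalabanUVNodes.N15.Gluing

end
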